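import Literature.NumberTheory.Transcendental.KaehlerHodgeLaplacianDProofs
import HarnessLib

/-!
# `∂̄`-harmonic `(p,q)`-forms form a linear subspace (smooth Hermitian metric) — proofs

Companion of `Literature/NumberTheory/Transcendental/KaehlerHodge.lean` (C12),
concerning its named fact `Literature.NumberTheory.Transcendental.mem_dolbeaultHarmonicForms_iff`
("`α ∈ dolbeaultHarmonicForms o p q h ↔ IsDolbeaultHarmonic o p q h α` for `p + q = k`", i.e. the
`∂̄`-harmonic forms of type `(p,q)`, `{α smooth, of type (p,q), Δ_∂̄ α = 0}`, already form a
`ℂ`-linear subspace of the complex `k`-forms, so that their `ℂ`-span `dolbeaultHarmonicForms` adds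
nothing).

Source. C. Voisin, *Hodge Theory and Complex Algebraic Geometry I* (2002), §5.1.4 *Laplacians*
(p. 124): for a complex manifold with a Hermitian metric, `Δ_∂̄ = ∂̄∂̄* + ∂̄*∂̄` is an operator
"which acts on the `C^∞` differential forms of degree `k` for each `k`" (a `ℂ`-linear differential
operator, cf. §5.2.1 Def. 5.15), Def. 5.14 (`Δ_∂̄`-harmonic forms), and §6.1.2 (p. 142): "`ℋ^{p,q}`
is the set of forms of type `(p,q)` which are harmonic"; the kernel of a linear operator on the
linear space `A^{p,q}(X)` is a linear subspace. Also D. Huybrechts, *Complex Geometry* (2005),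
§3.2, Def. 3.2.4–Lemma 3.2.5 (`ℋ^{p,q}_∂̄(X, g) := ker Δ_∂̄`).

## Status of `mem_dolbeaultHarmonicForms_iff` (misstated: dropped instances)

In Voisin a Hermitian metric is `C^∞` (§3.1.1). The named fact sits in the section *Generic
smoothness statements* of `KaehlerHodge.lean`, whose instance variables
`[IsManifold 𝓘(ℂ, E) ω M] [IsManifold 𝓘(ℝ, E) ∞ M]`,
`[IsContinuousRiemannianBundle E (fun x ↦ TangentSpace 𝓘(ℝ, E) x)]`,
`[IsContMDiffRiemannianBundle 𝓘(ℝ, E) ∞ E (fun x ↦ TangentSpace 𝓘(ℝ, E) x)]` are **not used in the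
body** of this `def … : Prop` and were therefore not abstracted: `#check @mem_dolbeaultHarmonicForms_iff`
binds, as regards the metric, only `[RiemannianBundle fun x ↦ TangentSpace 𝓘(ℝ, E) x]` — Mathlib's
fibrewise inner product of *no regularity in the base point* — and, as regards the atlas, only
`[ChartedSpace E M]`. This is the same defect as for the real analogue
`Literature.Geometry.Kaehler.mem_harmonicForms_iff` (`RiemannianHodge.lean`), refuted for a rough
metric on `ℝ²` in `Literature/Geometry/Kaehler/RiemannianHodgeRoughMetric.lean` and proved for smooth
metrics as `Literature.Geometry.Kaehler.mem_harmonicForms_iff_of_contMDiffMetric`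
(`RiemannianHodgeSmoothProofs.lean`). For a rough metric the complex statement fails in the same
way: `mextDeriv` (hence `∂`, `∂̄`) is `fderivWithin`-based and takes the junk value `0` wherever a
form is not differentiable, `⋆` of a smooth form need not be differentiable, and additivity of
`Δ_∂̄ = -∂̄⋆∂⋆ - ⋆∂⋆∂̄` on smooth forms is lost (on `ℂ` with the unit-determinant metric
`g = (dx + u dy)² + dy²`, `u = (|x|·𝟙_ℚ(x))^{1/2}`, the smooth functions
`|z|² + z̄ + (i/2)|z|² z̄` and `-z̄ - (i/2)|z|² z̄` are "`Δ_∂̄`-harmonic" while their sum `|z|²` is not: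
`Δ_∂̄ |z|² (0) = -2`; formalised in `KaehlerHodgeRoughMetric.lean`,
`not_forall_mem_dolbeaultHarmonicForms_iff`). So `mem_dolbeaultHarmonicForms_iff_holds` cannot be
proved; this file proves the statement under the intended instances and vendors the correctly
hypothesised closed statement.

## Contents (all proved; no new unproved fact)

* Unconditional algebra: `dolbeaultBarAdjoint_smul`, `dolbeaultLaplacian_smul`,
  `IsDolbeaultHarmonic.smul` (scalars need no smoothness: `⋆` is `ℂ`-linear and
  `∂(cα) = c ∂α`, `∂̄(cα) = c ∂̄α` unconditionally, `dolbeault_smul_holds`, `dolbeaultBar_smul_holds`).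
* For a smooth metric on a complex manifold (`[IsManifold 𝓘(ℂ, E) ω M] [IsManifold 𝓘(ℝ, E) ∞ M]
  [IsContMDiffRiemannianBundle 𝓘(ℝ, E) ∞ E _]`) and an orientation family with smooth volume form:
  additivity `dolbeaultLaplacian_add` (from the tree's `dolbeaultBar_add'`,
  `dolbeaultBarAdjoint_add`, `IsSmoothForm.dolbeaultBar`, `IsSmoothForm.dolbeaultBarAdjoint` of
  `KaehlerHodgeLaplacianProofs.lean` / `KaehlerHodgeLaplacianDProofs.lean`),
  `IsDolbeaultHarmonic.add`, and the fact as declared under the intended instances,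
  `mem_dolbeaultHarmonicForms_iff_of_contMDiffMetric : mem_dolbeaultHarmonicForms_iff o`
  (by `Submodule.span_induction`).
* The corrected named fact `mem_dolbeaultHarmonicForms_iff_of_isContMDiffRiemannianBundle` (the
  intended hypotheses bound *inside* the closed statement, as for
  `Literature.NumberTheory.Transcendental.isSmoothForm_cHodgeStar_of_isContMDiffRiemannianBundle`)
  and its discharge `mem_dolbeaultHarmonicForms_iff_of_isContMDiffRiemannianBundle_holds`.

Inputs: smoothness of the complex Hodge star for a smooth metric (`IsSmoothForm.cHodgeStar`,
`KaehlerHodgeSmoothProofs.lean`; Warner (1983), 4.10 (6)), chart independence of `d`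
(`inChart_mextDeriv_holds`), smoothness of type components on a complex manifold
(`isSmoothForm_typeComponent_holds`, Voisin (2002), §2.3.1), additivity of `∂`, `∂̄`, `∂̄*` on
smooth forms (`dolbeault_add'`, `dolbeaultBar_add'`, `dolbeaultBarAdjoint_add`). The formal
refutation of the fact as declared (rough shear metric on `ℂ`) is
`Literature/NumberTheory/Transcendental/KaehlerHodgeRoughMetric.lean`.

## References

* C. Voisin, *Hodge Theory and Complex Algebraic Geometry I*, Cambridge Studies in Advanced
  Mathematics 76 (2002), §5.1.4 (p. 124), Def. 5.14; §6.1.2 (pp. 141–142). [cite: Voisin2002]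
* D. Huybrechts, *Complex Geometry. An Introduction*, Universitext (2005), §3.2, Def. 3.2.4,
  Lemma 3.2.5.
* F. W. Warner, *Foundations of Differentiable Manifolds and Lie Groups*, GTM 94 (1983), 4.10 (6),
  6.1.
-/

noncomputable section

open scoped Manifold ContDiff Topology
open Bundle Module Set Finset

namespace Literature.NumberTheory.Transcendental

open Literature.Geometry.Kaehler

variable {E : Type*} [NormedAddCommGroup E] [NormedSpace ℂ E]
  {M : Type*} [TopologicalSpace M] [ChartedSpace E M] {k m : ℕ}
  [FiniteDimensional ℂ E] {n : ℕ} [Fact (finrank ℝ E = n)]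
  [RiemannianBundle (fun x : M ↦ TangentSpace 𝓘(ℝ, E) x)]
  (o : (x : M) → Orientation ℝ (TangentSpace 𝓘(ℝ, E) x) (Fin n))

/-! ### Unconditional algebra: scalars -/

/-- `∂̄*` commutes with complex scalars, with no smoothness hypothesis: `∂̄*(cα) = c ∂̄*α`
(`⋆` is `ℂ`-linear and `∂(cβ) = c ∂β` unconditionally, `dolbeault_smul_holds`).
Voisin (2002), §5.1.2–5.1.4; Huybrechts (2005), Def. 3.2.4. [cite: Voisin2002, §5.1.4, p. 124] -/
theorem dolbeaultBarAdjoint_smul (h : (k + 1) + m = n) (c : ℂ) (α : MForm 𝓘(ℝ, E) M ℂ (k + 1)) :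
    dolbeaultBarAdjoint o h (c • α) = c • dolbeaultBarAdjoint o h α := by
  simp only [dolbeaultBarAdjoint, map_smul, dolbeault_smul_holds c, smul_neg]

/-- The `∂̄`-Laplacian commutes with complex scalars, with no smoothness hypothesis:
`Δ_∂̄ (cα) = c Δ_∂̄ α`. Voisin (2002), §5.1.4 (p. 124). [cite: Voisin2002, §5.1.4, p. 124] -/
theorem dolbeaultLaplacian_smul (h : k + m = n) (c : ℂ) (α : MForm 𝓘(ℝ, E) M ℂ k) :
    dolbeaultLaplacian o k m h (c • α) = c • dolbeaultLaplacian o k m h α := by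
  rcases k with - | k <;> rcases m with - | m
  · simp [dolbeaultLaplacian]
  · simp only [dolbeaultLaplacian, dolbeaultBar_smul_holds c, dolbeaultBarAdjoint_smul]
  · simp only [dolbeaultLaplacian, dolbeaultBarAdjoint_smul, dolbeaultBar_smul_holds c]
  · simp only [dolbeaultLaplacian, dolbeaultBarAdjoint_smul, dolbeaultBar_smul_holds c, smul_add]

/-- Complex multiples of `∂̄`-harmonic `(p,q)`-forms are `∂̄`-harmonic of type `(p,q)`
(unconditionally). Voisin (2002), §5.1.4, Def. 5.14; §6.1.2. [cite: Voisin2002, §5.1.4 Def. 5.14] -/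
theorem IsDolbeaultHarmonic.smul {p q : ℕ} (h : k + m = n) {α : MForm 𝓘(ℝ, E) M ℂ k}
    (hα : IsDolbeaultHarmonic o p q h α) (c : ℂ) : IsDolbeaultHarmonic o p q h (c • α) :=
  ⟨hα.1.smul_complex c, hα.2.1.smul c, by rw [dolbeaultLaplacian_smul, hα.2.2, smul_zero]⟩

/-! ### Smooth metric on a complex manifold: additivity of `Δ_∂̄`, the subspace `ℋ^{p,q}` -/

section Smooth

variable [IsManifold 𝓘(ℂ, E) ω M] [IsManifold 𝓘(ℝ, E) ∞ M]
  [IsContMDiffRiemannianBundle 𝓘(ℝ, E) ∞ E (fun x : M ↦ TangentSpace 𝓘(ℝ, E) x)]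

/-- **Additivity of the `∂̄`-Laplacian on smooth forms** (complex manifold, smooth metric, smooth
volume form): `Δ_∂̄(α + β) = Δ_∂̄ α + Δ_∂̄ β` — Voisin's "`Δ_∂̄` acts on the `C^∞` differential
forms" as a (linear differential) operator, §5.1.4 (p. 124). The four cases of the pattern-matching
definition of `dolbeaultLaplacian`, from additivity of `∂̄` and `∂̄*` on smooth forms
(`dolbeaultBar_add'`, `dolbeaultBarAdjoint_add`) and smoothness of `∂̄α`, `∂̄*α`
(`IsSmoothForm.dolbeaultBar`, `IsSmoothForm.dolbeaultBarAdjoint`). [cite: Voisin2002, §5.1.4, p. 124] -/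
theorem dolbeaultLaplacian_add (ho : IsSmoothForm (riemannianVolumeForm o)) (h : k + m = n)
    {α β : MForm 𝓘(ℝ, E) M ℂ k} (hα : IsSmoothForm α) (hβ : IsSmoothForm β) :
    dolbeaultLaplacian o k m h (α + β) =
      dolbeaultLaplacian o k m h α + dolbeaultLaplacian o k m h β := by
  rcases k with - | k <;> rcases m with - | m
  · simp [dolbeaultLaplacian]
  · simp only [dolbeaultLaplacian]
    rw [dolbeaultBar_add' hα hβ, dolbeaultBarAdjoint_add o ho _ hα.dolbeaultBar hβ.dolbeaultBar]
  · simp only [dolbeaultLaplacian]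
    rw [dolbeaultBarAdjoint_add o ho _ hα hβ,
      dolbeaultBar_add' (IsSmoothForm.dolbeaultBarAdjoint o ho _ hα)
        (IsSmoothForm.dolbeaultBarAdjoint o ho _ hβ)]
  · simp only [dolbeaultLaplacian]
    rw [dolbeaultBarAdjoint_add o ho _ hα hβ,
      dolbeaultBar_add' (IsSmoothForm.dolbeaultBarAdjoint o ho _ hα)
        (IsSmoothForm.dolbeaultBarAdjoint o ho _ hβ),
      dolbeaultBar_add' hα hβ, dolbeaultBarAdjoint_add o ho _ hα.dolbeaultBar hβ.dolbeaultBar]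
    abel

/-- Sums of `∂̄`-harmonic `(p,q)`-forms are `∂̄`-harmonic of type `(p,q)` (complex manifold, smooth
metric, smooth volume form). Voisin (2002), §5.1.4, Def. 5.14; §6.1.2. [cite: Voisin2002, §5.1.4 Def. 5.14] -/
theorem IsDolbeaultHarmonic.add (ho : IsSmoothForm (riemannianVolumeForm o)) {p q : ℕ}
    (h : k + m = n) {α β : MForm 𝓘(ℝ, E) M ℂ k} (hα : IsDolbeaultHarmonic o p q h α)
    (hβ : IsDolbeaultHarmonic o p q h β) : IsDolbeaultHarmonic o p q h (α + β) :=
  ⟨hα.1.add hβ.1, hα.2.1.add hβ.2.1, by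
    rw [dolbeaultLaplacian_add o ho h hα.1 hβ.1, hα.2.2, hβ.2.2, add_zero]⟩

/-- **The named fact `mem_dolbeaultHarmonicForms_iff o` under its intended instances.** On a
complex manifold with a smooth metric (and an orientation family with smooth volume form),
membership in `dolbeaultHarmonicForms o p q h` is being `∂̄`-harmonic of type `(p,q)` when
`p + q = k`: the `∂̄`-harmonic `(p,q)`-forms contain `0` and are closed under `+` and `•`, so their
span is themselves (`Submodule.span_induction`). Voisin (2002), §5.1.4 (p. 124), Def. 5.14, §6.1.2
(p. 142: "`ℋ^{p,q}` is the set of forms of type `(p,q)` which are harmonic"); Huybrechts (2005),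
§3.2. [cite: Voisin2002, §5.1.4 Def. 5.14; §6.1.2 p. 142] -/
theorem mem_dolbeaultHarmonicForms_iff_of_contMDiffMetric :
    mem_dolbeaultHarmonicForms_iff (k := k) (m := m) o := by
  intro ho p q hpq h α
  refine ⟨fun hα ↦ ?_, fun hα ↦ hα.mem_dolbeaultHarmonicForms⟩
  induction hα using Submodule.span_induction with
  | mem x hx => exact hx
  | zero => exact isDolbeaultHarmonic_zero o hpq h
  | add x y _ _ hx hy => exact hx.add o ho h hy
  | smul c x _ hx => exact hx.smul o h c

end Smooth

/-! ### The corrected named fact -/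

section CorrectedFact

/-- **Corrected statement of the named fact
`Literature.NumberTheory.Transcendental.mem_dolbeaultHarmonicForms_iff`** (`KaehlerHodge.lean`). On a
complex manifold `M` (holomorphic atlas, `[IsManifold 𝓘(ℂ, E) ω M]`) with a *smooth* Riemannian
metric on the real tangent bundle (`[IsContMDiffRiemannianBundle 𝓘(ℝ, E) ∞ E _]`) and an
orientation family `o` with smooth volume form, for `p + q = k` a complex `k`-form lies in the
`ℂ`-span `dolbeaultHarmonicForms o p q h` of the `∂̄`-harmonic `(p,q)`-forms iff it is itself
`∂̄`-harmonic of type `(p,q)` — i.e. `ℋ^{p,q} = {α ∈ A^{p,q} : Δ_∂̄ α = 0}` is a linear subspace,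
`Δ_∂̄` being a linear operator on the `C^∞` forms (Voisin (2002), §5.1.4, p. 124, Def. 5.14;
§6.1.2, p. 142).

Discrepancy with the original: `def mem_dolbeaultHarmonicForms_iff` is declared in a section whose
instance variables `[IsManifold 𝓘(ℂ, E) ω M] [IsManifold 𝓘(ℝ, E) ∞ M]
[IsContinuousRiemannianBundle E _] [IsContMDiffRiemannianBundle 𝓘(ℝ, E) ∞ E _]` are *not used in
its body* and hence are not hypotheses of the fact (a `def` abstracts only the section variables it
mentions): as declared it quantifies over every fibrewise family of inner products
(`Bundle.RiemannianBundle`, no regularity in the base point) on any charted space, for which it is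
false — `Δ_∂̄ = -∂̄⋆∂⋆ - ⋆∂⋆∂̄` is then not additive on smooth forms (`∂`, `∂̄` take the junk value
`0` at points where `⋆α` is not differentiable); the formal refutation is
`Literature.NumberTheory.Transcendental.not_forall_mem_dolbeaultHarmonicForms_iff`
(`KaehlerHodgeRoughMetric.lean`, a rough shear metric on `ℂ`), exactly as for the real analogue
`Literature.Geometry.Kaehler.mem_harmonicForms_iff`
(`Literature/Geometry/Kaehler/RiemannianHodgeRoughMetric.lean`). Here the intended hypotheses are
bound *inside* the closed statement (`IsContinuousRiemannianBundle` is not needed); it is discharged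
by `mem_dolbeaultHarmonicForms_iff_of_isContMDiffRiemannianBundle_holds`, and the usable form is
`mem_dolbeaultHarmonicForms_iff_of_contMDiffMetric`. [cite: Voisin2002, §5.1.4 Def. 5.14; §6.1.2 p. 142] -/
def mem_dolbeaultHarmonicForms_iff_of_isContMDiffRiemannianBundle : Prop :=
  ∀ {E : Type*} [NormedAddCommGroup E] [NormedSpace ℂ E] [FiniteDimensional ℂ E] {n : ℕ}
    [Fact (finrank ℝ E = n)] {M : Type*} [TopologicalSpace M] [ChartedSpace E M]
    [IsManifold 𝓘(ℂ, E) ω M] [IsManifold 𝓘(ℝ, E) ∞ M]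
    [RiemannianBundle (fun x : M ↦ TangentSpace 𝓘(ℝ, E) x)]
    [IsContMDiffRiemannianBundle 𝓘(ℝ, E) ∞ E (fun x : M ↦ TangentSpace 𝓘(ℝ, E) x)] {k m : ℕ}
    (o : (x : M) → Orientation ℝ (TangentSpace 𝓘(ℝ, E) x) (Fin n)),
    mem_dolbeaultHarmonicForms_iff (k := k) (m := m) o

/-- **Discharge** of `mem_dolbeaultHarmonicForms_iff_of_isContMDiffRiemannianBundle` (the corrected
form of the named fact `mem_dolbeaultHarmonicForms_iff`): immediate from
`mem_dolbeaultHarmonicForms_iff_of_contMDiffMetric`. Voisin (2002), §5.1.4 (p. 124), Def. 5.14;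
§6.1.2 (p. 142). [cite: Voisin2002, §5.1.4 Def. 5.14; §6.1.2 p. 142] -/
theorem mem_dolbeaultHarmonicForms_iff_of_isContMDiffRiemannianBundle_holds :
    mem_dolbeaultHarmonicForms_iff_of_isContMDiffRiemannianBundle :=
  fun o ↦ mem_dolbeaultHarmonicForms_iff_of_contMDiffMetric o

end CorrectedFact

end Literature.NumberTheory.Transcendental
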